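import Literature.Barriers.Parity.SiegelZeroDichotomyPairHLTypeIModel
import Literature.Barriers.Parity.SiegelZeroDichotomyPairHLProp71Smooth
import Literature.Barriers.Parity.SiegelZeroDichotomyPairHLDoubleAbel
import HarnessLib

/-!
# Tao–Teräväinen 2022, Proposition 7.1: the weight `Φ̃_t(n₂) ψ_I(n₁n₂)` and the `Y`-bound

Topic `Literature/Barriers/Parity`, sub-namespace `TaoTeravainen`; a file of the proof DAG of
`Literature.Barriers.Parity.TaoTeravainen2021_prop72_81_pair` (T. Tao, J. Teräväinen, *The
Hardy–Littlewood–Chowla conjecture in the presence of a Siegel zero*, J. London Math. Soc. (2) 106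
(2022), arXiv:2109.06291), proof of Proposition 7.1 (i), the quantity `Y`: "From repeated
summation by parts we have
`∑_{n₁,n₂} Φ̃_t(n₂) ψ_I(n₁n₂) e_q(u₁n₁ + u₂n₂) ≪_ε x^{-1+O(ε)} (x/t)/‖u₁/q‖ · t/‖u₂/q‖ = x^{O(ε)}/(‖u₁/q‖ ‖u₂/q‖)`."
Everything here is PROVED, in explicit form:

* `hypWeight φ A B Δ v n₁ n₂ = G(n₁,n₂) := Φ̃_t(n₂) ψ_I(n₁ n₂)` (`t = e^v`, `Φ̃_t(n) = φ'(log(n/t))`,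
  `ψ_I = plateauProfile A B Δ`), its vanishing for `n₁ = 0`, `n₂ = 0`, `n₂ ∉ [t/e, et]`;
* `abs_mixedDiff_hypWeight_le` — the pointwise bound for the mixed second difference
  `|Δ₁Δ₂G(j₁,j₂)| ≤ C_G (1/Δ + x/Δ²)` (mean value theorem for `ψ_I`, `ψ_I'` with (7.4), and for
  `y ↦ φ'(log y - v)`), and its vanishing off `j₂ ∈ [t/e, et + 1]`, `(j₁-1)(j₂-1) < B`;
* `sum_abs_mixedDiff_hypWeight_le` — `∑_{j₁,j₂ ≥ 1} |Δ₁Δ₂G(j₁,j₂)| ≤ 200 x · C_G (1/Δ + x/Δ²)`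
  for `2e ≤ t ≤ x`, `B ≤ 3x` (the source's `x^{O(ε)}` with `Δ = x^{1-2ε}`);
* **`norm_sum_hypWeight_mul_e_le`** — the `Y`-bound for one frequency pair:
  `|∑_{n₁,n₂ ≤ M} G(n₁,n₂) z₁^{n₁} z₂^{n₂}| ≤ 4 (∑|Δ₁Δ₂G|)/(|z₁-1| |z₂-1|)` for `|zᵢ| = 1 ≠ zᵢ`
  (the double Abel summation of `SiegelZeroDichotomyPairHLDoubleAbel.lean`).
  [cite: TaoTeravainen2021, proof of Proposition 7.1 (the estimate for Y)]
-/

noncomputable section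

open Finset Real
open scoped ContDiff Topology

namespace Literature.Barriers.Parity

namespace TaoTeravainen

open Literature.Analysis.Calculus

/-! ### Bounds for `φ''` -/

namespace IsBump

variable {φ : ℝ → ℝ} (hφ : IsBump φ)
include hφ

/-- `φ''` is bounded. [folklore] -/
theorem exists_bound_deriv2 : ∃ B : ℝ, 0 ≤ B ∧ ∀ u, |deriv (deriv φ) u| ≤ B := by
  have hc : Continuous (deriv (deriv φ)) := by
    have h2 : ((2 : ℕ) : WithTop ℕ∞) ≤ ∞ := ENat.natCast_le_of_coe_top_le_withTop le_rfl 2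
    have := hφ.contDiff.continuous_iteratedDeriv 2 h2
    rwa [iteratedDeriv_succ, iteratedDeriv_one] at this
  have hs : HasCompactSupport (deriv (deriv φ)) := hφ.hasCompactSupport.deriv.deriv
  obtain ⟨B, hB⟩ := hc.norm.bddAbove_range_of_hasCompactSupport hs.norm
  refine ⟨max B 0, le_max_right _ _, fun u => ?_⟩
  have := hB ⟨u, rfl⟩
  simp only [Real.norm_eq_abs] at this
  exact this.trans (le_max_left _ _)

/-- `φ'` vanishes off `[-1, 1]`. [folklore] -/
theorem deriv_eq_zero {u : ℝ} (hu : 1 < |u|) : deriv φ u = 0 := by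
  have h : φ =ᶠ[𝓝 u] fun _ => (0 : ℝ) := by
    rcases lt_abs.mp hu with h | h
    · filter_upwards [Ioi_mem_nhds h] with w hw
      have hw' : 1 < w := hw
      exact hφ.eq_zero w (le_of_lt (lt_of_lt_of_le hw' (le_abs_self w)))
    · filter_upwards [Iio_mem_nhds (show u < -1 by linarith)] with w hw
      have hw' : w < -1 := hw
      exact hφ.eq_zero w (by rw [abs_of_neg (by linarith)]; linarith)
  rw [h.deriv_eq, deriv_const]

/-- `φ'` is differentiable with derivative `φ''`. [folklore] -/
theorem hasDerivAt_deriv (u : ℝ) : HasDerivAt (deriv φ) (deriv (deriv φ) u) u := by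
  have hd : Differentiable ℝ (deriv φ) := by
    have := hφ.contDiff.differentiable_iteratedDeriv 1 (by exact_mod_cast ENat.coe_lt_top 1)
    rwa [iteratedDeriv_one] at this
  exact hd.differentiableAt.hasDerivAt

end IsBump

/-! ### The weight `G(n₁,n₂) = Φ̃_t(n₂) ψ_I(n₁n₂)` -/

/-- `Φ̃_t(n) = φ'(log n - v)` for `n ≥ 1` (`t = e^v`), and `0` at `n = 0`.
[cite: TaoTeravainen2021, proof of Proposition 7.1] -/
def hypDerivWeight (φ : ℝ → ℝ) (v : ℝ) (n : ℕ) : ℝ :=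
  if n = 0 then 0 else deriv φ (Real.log n - v)

/-- `G(n₁,n₂) := Φ̃_t(n₂) ψ_I(n₁ n₂)`. [cite: TaoTeravainen2021, proof of Proposition 7.1] -/
def hypWeight (φ : ℝ → ℝ) (A B Δ v : ℝ) (n₁ n₂ : ℕ) : ℝ :=
  hypDerivWeight φ v n₂ * plateauProfile A B Δ ((n₁ * n₂ : ℕ) : ℝ)

/-- `|Φ̃_t(n)| ≤ sup|φ'|`. [folklore] -/
theorem abs_hypDerivWeight_le {φ : ℝ → ℝ} {B₁ : ℝ} (hB₁ : ∀ u, |deriv φ u| ≤ B₁) (v : ℝ) (n : ℕ) :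
    |hypDerivWeight φ v n| ≤ B₁ := by
  unfold hypDerivWeight
  split_ifs
  · rw [abs_zero]; exact (abs_nonneg _).trans (hB₁ 0)
  · exact hB₁ _

/-- `Φ̃_t(n) = 0` unless `e^{v-1} ≤ n ≤ e^{v+1}`. [cite: TaoTeravainen2021, §7 ("a smooth cutoff to
the interval `[t/e, et]`")] -/
theorem hypDerivWeight_eq_zero {φ : ℝ → ℝ} (hφ : IsBump φ) {v : ℝ} {n : ℕ}
    (hn : (n : ℝ) < Real.exp (v - 1) ∨ Real.exp (v + 1) < n) : hypDerivWeight φ v n = 0 := by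
  unfold hypDerivWeight
  split_ifs with h0
  · rfl
  · have hnpos : (0 : ℝ) < n := by exact_mod_cast Nat.pos_of_ne_zero h0
    refine hφ.deriv_eq_zero ?_
    rcases hn with hn | hn
    · have : Real.log n < v - 1 := by
        rw [Real.log_lt_iff_lt_exp hnpos]; exact hn
      rw [abs_of_neg (by linarith)]; linarith
    · have : v + 1 < Real.log n := by
        rw [Real.lt_log_iff_exp_lt hnpos]; exact hn
      rw [abs_of_pos (by linarith)]; linarith

/-- `G(0, n₂) = 0` when `0 ≤ A` (`ψ_I(0) = 0`). [folklore] -/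
theorem hypWeight_zero_left {φ : ℝ → ℝ} {A B Δ : ℝ} (hA : 0 ≤ A) (hΔ : 0 < Δ) (v : ℝ) (n₂ : ℕ) :
    hypWeight φ A B Δ v 0 n₂ = 0 := by
  unfold hypWeight
  rw [zero_mul, Nat.cast_zero, plateauProfile_eq_zero_of_le hΔ hA, mul_zero]

/-- `G(n₁, 0) = 0`. [folklore] -/
theorem hypWeight_zero_right (φ : ℝ → ℝ) (A B Δ v : ℝ) (n₁ : ℕ) : hypWeight φ A B Δ v n₁ 0 = 0 := by
  unfold hypWeight hypDerivWeight
  rw [if_pos rfl, zero_mul]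

/-- `|G| ≤ sup|φ'|`. [folklore] -/
theorem abs_hypWeight_le {φ : ℝ → ℝ} {B₁ : ℝ} (hB₁ : ∀ u, |deriv φ u| ≤ B₁) (A B Δ v : ℝ)
    (n₁ n₂ : ℕ) : |hypWeight φ A B Δ v n₁ n₂| ≤ B₁ := by
  unfold hypWeight
  rw [abs_mul]
  calc |hypDerivWeight φ v n₂| * |plateauProfile A B Δ ((n₁ * n₂ : ℕ) : ℝ)| ≤ B₁ * 1 :=
        mul_le_mul (abs_hypDerivWeight_le hB₁ v n₂) (abs_plateauProfile_le_one _ _ _ _)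
          (abs_nonneg _) ((abs_nonneg _).trans (hB₁ 0))
    _ = B₁ := mul_one _

/-! ### Lipschitz bounds -/

/-- `ψ_I` is `K₁/Δ`-Lipschitz. [cite: TaoTeravainen2021, proof of Proposition 7.1, (7.4)] -/
theorem abs_plateauProfile_sub_le {A B Δ : ℝ} (hΔ : 0 < Δ) (y y' : ℝ) :
    |plateauProfile A B Δ y - plateauProfile A B Δ y'| ≤ plateauDerivConst 1 / Δ * |y - y'| := by
  have hd : ∀ z ∈ (Set.univ : Set ℝ), DifferentiableAt ℝ (plateauProfile A B Δ) z := fun z _ =>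
    ((contDiff_plateauProfile A B Δ).differentiable (by simp)).differentiableAt
  have hb : ∀ z ∈ (Set.univ : Set ℝ), ‖deriv (plateauProfile A B Δ) z‖ ≤ plateauDerivConst 1 / Δ := by
    intro z _
    rw [← iteratedDeriv_one, Real.norm_eq_abs]
    have := abs_iteratedDeriv_plateauProfile_le' 1 (A := A) (B := B) hΔ z
    rwa [pow_one] at this
  have := Convex.norm_image_sub_le_of_norm_deriv_le hd hb convex_univ (Set.mem_univ y') (Set.mem_univ y)
  rwa [Real.norm_eq_abs, Real.norm_eq_abs] at this

/-- `ψ_I'` is `K₂/Δ²`-Lipschitz. [cite: TaoTeravainen2021, proof of Proposition 7.1, (7.4)] -/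
theorem abs_deriv_plateauProfile_sub_le {A B Δ : ℝ} (hΔ : 0 < Δ) (y y' : ℝ) :
    |deriv (plateauProfile A B Δ) y - deriv (plateauProfile A B Δ) y'| ≤
      plateauDerivConst 2 / Δ ^ 2 * |y - y'| := by
  have hsm := contDiff_plateauProfile A B Δ
  have hd : ∀ z ∈ (Set.univ : Set ℝ), DifferentiableAt ℝ (deriv (plateauProfile A B Δ)) z := by
    intro z _
    have := hsm.differentiable_iteratedDeriv 1 (by exact_mod_cast ENat.coe_lt_top 1)
    rw [iteratedDeriv_one] at this
    exact this.differentiableAt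
  have hb : ∀ z ∈ (Set.univ : Set ℝ), ‖deriv (deriv (plateauProfile A B Δ)) z‖ ≤
      plateauDerivConst 2 / Δ ^ 2 := by
    intro z _
    have h2 : deriv (deriv (plateauProfile A B Δ)) = iteratedDeriv 2 (plateauProfile A B Δ) := by
      rw [iteratedDeriv_succ, iteratedDeriv_one]
    rw [h2, Real.norm_eq_abs]
    exact abs_iteratedDeriv_plateauProfile_le' 2 hΔ z
  have := Convex.norm_image_sub_le_of_norm_deriv_le hd hb convex_univ (Set.mem_univ y') (Set.mem_univ y)
  rwa [Real.norm_eq_abs, Real.norm_eq_abs] at this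

/-- The double difference of `ψ_I` along a parallelogram:
`|[ψ(p+h) - ψ(p)] - [ψ(p'+h') - ψ(p')]| ≤ (K₁/Δ)|h - h'| + (K₂/Δ²)|h'| |p - p'|`. [folklore] -/
theorem abs_double_diff_plateauProfile_le {A B Δ : ℝ} (hΔ : 0 < Δ) (p p' h h' : ℝ) :
    |(plateauProfile A B Δ (p + h) - plateauProfile A B Δ p) -
        (plateauProfile A B Δ (p' + h') - plateauProfile A B Δ p')| ≤
      plateauDerivConst 1 / Δ * |h - h'| + plateauDerivConst 2 / Δ ^ 2 * |h'| * |p - p'| := by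
  set ψ := plateauProfile A B Δ with hψ
  -- `D(s) = ψ(p+s) - ψ(p'+s)` has derivative `ψ'(p+s) - ψ'(p'+s)`, bounded by `(K₂/Δ²)|p-p'|`
  have hsm := contDiff_plateauProfile A B Δ
  have hdiff : Differentiable ℝ ψ := hsm.differentiable (by simp)
  have hD : ∀ s ∈ (Set.univ : Set ℝ), DifferentiableAt ℝ (fun s => ψ (p + s) - ψ (p' + s)) s := by
    intro s _
    exact ((hdiff.differentiableAt).comp s (differentiableAt_id.const_add p)).sub
      ((hdiff.differentiableAt).comp s (differentiableAt_id.const_add p'))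
  have hD' : ∀ s ∈ (Set.univ : Set ℝ), ‖deriv (fun s => ψ (p + s) - ψ (p' + s)) s‖ ≤
      plateauDerivConst 2 / Δ ^ 2 * |p - p'| := by
    intro s _
    have h1 : deriv (fun s => ψ (p + s) - ψ (p' + s)) s = deriv ψ (p + s) - deriv ψ (p' + s) := by
      have e1 : HasDerivAt (fun s => ψ (p + s)) (deriv ψ (p + s)) s := by
        simpa using (hdiff.differentiableAt.hasDerivAt (x := p + s)).comp_const_add p s
      have e2 : HasDerivAt (fun s => ψ (p' + s)) (deriv ψ (p' + s)) s := by
        simpa using (hdiff.differentiableAt.hasDerivAt (x := p' + s)).comp_const_add p' s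
      exact (e1.sub e2).deriv
    rw [h1, Real.norm_eq_abs]
    have := abs_deriv_plateauProfile_sub_le (A := A) (B := B) hΔ (p + s) (p' + s)
    rwa [show p + s - (p' + s) = p - p' by ring] at this
  have hMVT := Convex.norm_image_sub_le_of_norm_deriv_le hD hD' convex_univ (Set.mem_univ 0)
    (Set.mem_univ h')
  simp only [add_zero, Real.norm_eq_abs, sub_zero] at hMVT
  -- `ψ(p+h) - ψ(p+h')`
  have hL := abs_plateauProfile_sub_le (A := A) (B := B) hΔ (p + h) (p + h')
  rw [show p + h - (p + h') = h - h' by ring] at hL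
  have hsplit : (ψ (p + h) - ψ p) - (ψ (p' + h') - ψ p') =
      (ψ (p + h) - ψ (p + h')) + ((ψ (p + h') - ψ (p' + h')) - (ψ (p + 0) - ψ (p' + 0))) := by
    simp only [add_zero]; ring
  rw [hsplit]
  refine (abs_add_le _ _).trans ?_
  have h2 : |(ψ (p + h') - ψ (p' + h')) - (ψ (p + 0) - ψ (p' + 0))| ≤
      plateauDerivConst 2 / Δ ^ 2 * |p - p'| * |h'| := by
    simpa only [add_zero] using hMVT
  calc |ψ (p + h) - ψ (p + h')| + |(ψ (p + h') - ψ (p' + h')) - (ψ (p + 0) - ψ (p' + 0))|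
      ≤ plateauDerivConst 1 / Δ * |h - h'| + plateauDerivConst 2 / Δ ^ 2 * |p - p'| * |h'| :=
        add_le_add hL h2
    _ = _ := by ring

/-- `y ↦ φ'(log y - v)` is `B₂/y₀`-Lipschitz on `[y₀, ∞)` for `y₀ > 0`. [folklore] -/
theorem abs_deriv_comp_log_sub_le {φ : ℝ → ℝ} (hφ : IsBump φ) {B₂ : ℝ}
    (hB₂ : ∀ u, |deriv (deriv φ) u| ≤ B₂) (v : ℝ) {y₀ : ℝ} (hy₀ : 0 < y₀) {y y' : ℝ}
    (hy : y₀ ≤ y) (hy' : y₀ ≤ y') :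
    |deriv φ (Real.log y - v) - deriv φ (Real.log y' - v)| ≤ B₂ / y₀ * |y - y'| := by
  have hB0 : 0 ≤ B₂ := (abs_nonneg _).trans (hB₂ 0)
  have hd : ∀ z ∈ Set.Ici y₀, DifferentiableAt ℝ (fun w => deriv φ (Real.log w - v)) z := by
    intro z hz
    have hz0 : z ≠ 0 := (lt_of_lt_of_le hy₀ hz).ne'
    exact (hφ.hasDerivAt_deriv _).differentiableAt.comp z
      ((Real.differentiableAt_log hz0).sub_const v)
  have hb : ∀ z ∈ Set.Ici y₀, ‖deriv (fun w => deriv φ (Real.log w - v)) z‖ ≤ B₂ / y₀ := by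
    intro z hz
    have hz0 : 0 < z := lt_of_lt_of_le hy₀ hz
    have h1 : HasDerivAt (fun w => deriv φ (Real.log w - v))
        (deriv (deriv φ) (Real.log z - v) * (1 / z)) z := by
      have := (hφ.hasDerivAt_deriv (Real.log z - v)).comp z
        ((Real.hasDerivAt_log hz0.ne').sub_const v)
      simpa [Function.comp_def, one_div] using this
    rw [h1.deriv, Real.norm_eq_abs, abs_mul, abs_of_pos (by positivity : (0 : ℝ) < 1 / z)]
    have hz' : y₀ ≤ z := hz
    calc |deriv (deriv φ) (Real.log z - v)| * (1 / z) ≤ B₂ * (1 / y₀) := by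
          gcongr
          exact hB₂ _
      _ = B₂ / y₀ := by ring
  have := Convex.norm_image_sub_le_of_norm_deriv_le hd hb (convex_Ici y₀) hy' hy
  rwa [Real.norm_eq_abs, Real.norm_eq_abs] at this

/-! ### The mixed second difference of `G` -/

/-- `G` as a complex double sequence. [folklore] -/
def hypWeightC (φ : ℝ → ℝ) (A B Δ v : ℝ) (n₁ n₂ : ℕ) : ℂ := (hypWeight φ A B Δ v n₁ n₂ : ℂ)

/-- The algebraic identity `Δ₁Δ₂G(j₁,j₂) = [a(j₂) - a(j₂-1)] Δb₁ + a(j₂-1) (Δb₁ - Δb₂)` with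
`a = Φ̃_t`, `b = ψ_I`, `Δb₁ = b(j₁j₂) - b((j₁-1)j₂)`, `Δb₂ = b(j₁(j₂-1)) - b((j₁-1)(j₂-1))`.
[folklore] -/
theorem mixedDiff_hypWeightC_eq (φ : ℝ → ℝ) (A B Δ v : ℝ) (j₁ j₂ : ℕ) :
    mixedDiff (hypWeightC φ A B Δ v) j₁ j₂ =
      (((hypDerivWeight φ v j₂ - hypDerivWeight φ v (j₂ - 1)) *
          (plateauProfile A B Δ ((j₁ * j₂ : ℕ) : ℝ) - plateauProfile A B Δ (((j₁ - 1) * j₂ : ℕ) : ℝ)) +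
        hypDerivWeight φ v (j₂ - 1) *
          ((plateauProfile A B Δ ((j₁ * j₂ : ℕ) : ℝ) - plateauProfile A B Δ (((j₁ - 1) * j₂ : ℕ) : ℝ)) -
            (plateauProfile A B Δ ((j₁ * (j₂ - 1) : ℕ) : ℝ) -
              plateauProfile A B Δ (((j₁ - 1) * (j₂ - 1) : ℕ) : ℝ))) : ℝ) : ℂ) := by
  unfold mixedDiff hypWeightC hypWeight
  push_cast
  ring

/-- `|a(j₂) - a(j₂-1)| ≤ 2 sup|φ''| / j₂` for `j₂ ≥ 1`, `v ≥ 2`. [folklore] -/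
theorem abs_hypDerivWeight_sub_le {φ : ℝ → ℝ} (hφ : IsBump φ) {B₂ : ℝ}
    (hB₂ : ∀ u, |deriv (deriv φ) u| ≤ B₂) {v : ℝ} (hv : 2 ≤ v) {j₂ : ℕ} (hj₂ : 1 ≤ j₂) :
    |hypDerivWeight φ v j₂ - hypDerivWeight φ v (j₂ - 1)| ≤ 2 * B₂ / j₂ := by
  have hB0 : 0 ≤ B₂ := (abs_nonneg _).trans (hB₂ 0)
  rcases Nat.lt_or_ge j₂ 2 with h | h
  · -- `j₂ = 1`: `a(1) = φ'(-v) = 0`, `a(0) = 0`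
    have hj : j₂ = 1 := by omega
    subst hj
    have h1 : hypDerivWeight φ v 1 = 0 := by
      unfold hypDerivWeight
      rw [if_neg one_ne_zero, Nat.cast_one, Real.log_one, zero_sub]
      exact hφ.deriv_eq_zero (by rw [abs_neg, abs_of_pos (by linarith)]; linarith)
    have h0 : hypDerivWeight φ v (1 - 1) = 0 := by
      unfold hypDerivWeight; simp
    rw [h1, h0, sub_zero, abs_zero]
    positivity
  · have hj1 : (1 : ℝ) ≤ ((j₂ - 1 : ℕ) : ℝ) := by
      have : 1 ≤ j₂ - 1 := by omega
      exact_mod_cast this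
    have hne : j₂ ≠ 0 := by omega
    have hne' : j₂ - 1 ≠ 0 := by omega
    unfold hypDerivWeight
    rw [if_neg hne, if_neg hne']
    have hmvt := abs_deriv_comp_log_sub_le hφ hB₂ v (y₀ := ((j₂ - 1 : ℕ) : ℝ)) (by linarith)
      (y := (j₂ : ℝ)) (y' := ((j₂ - 1 : ℕ) : ℝ)) (by push_cast [Nat.cast_sub (by omega : 1 ≤ j₂)]; linarith)
      le_rfl
    refine hmvt.trans ?_
    have hdiff : |(j₂ : ℝ) - ((j₂ - 1 : ℕ) : ℝ)| = 1 := by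
      rw [Nat.cast_sub (by omega : 1 ≤ j₂), Nat.cast_one]
      rw [show (j₂ : ℝ) - ((j₂ : ℝ) - 1) = 1 by ring, abs_one]
    rw [hdiff, mul_one]
    have hjpos : (0 : ℝ) < j₂ := by exact_mod_cast (by omega : 0 < j₂)
    have hj2 : (j₂ : ℝ) ≤ 2 * ((j₂ - 1 : ℕ) : ℝ) := by
      rw [Nat.cast_sub (by omega : 1 ≤ j₂), Nat.cast_one]
      have : (2 : ℝ) ≤ j₂ := by exact_mod_cast h
      linarith
    rw [div_le_div_iff₀ (by linarith) hjpos]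
    nlinarith

/-- **The pointwise bound**: for `j₁, j₂ ≥ 1`, `v ≥ 2`, `Δ > 0`,
`|Δ₁Δ₂G(j₁,j₂)| ≤ (2 sup|φ''| + sup|φ'|) K₁/Δ + sup|φ'| K₂ (j₁-1)(j₂-1)/Δ²`.
[cite: TaoTeravainen2021, proof of Proposition 7.1 (the estimate for Y, "repeated summation by
parts")] -/
theorem norm_mixedDiff_hypWeightC_le {φ : ℝ → ℝ} (hφ : IsBump φ) {B₁ B₂ : ℝ}
    (hB₁ : ∀ u, |deriv φ u| ≤ B₁) (hB₂ : ∀ u, |deriv (deriv φ) u| ≤ B₂) {A B Δ v : ℝ} (hΔ : 0 < Δ)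
    (hv : 2 ≤ v) {j₁ j₂ : ℕ} (hj₁ : 1 ≤ j₁) (hj₂ : 1 ≤ j₂) :
    ‖mixedDiff (hypWeightC φ A B Δ v) j₁ j₂‖ ≤
      (2 * B₂ + B₁) * plateauDerivConst 1 / Δ +
        B₁ * plateauDerivConst 2 * (((j₁ - 1 : ℕ) : ℝ) * ((j₂ - 1 : ℕ) : ℝ)) / Δ ^ 2 := by
  have hB₁0 : 0 ≤ B₁ := (abs_nonneg _).trans (hB₁ 0)
  have hB₂0 : 0 ≤ B₂ := (abs_nonneg _).trans (hB₂ 0)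
  have hK1 := plateauDerivConst_nonneg 1
  have hK2 := plateauDerivConst_nonneg 2
  rw [mixedDiff_hypWeightC_eq, Complex.norm_real, Real.norm_eq_abs]
  set ψ := plateauProfile A B Δ with hψdef
  set a := hypDerivWeight φ v with hadef
  -- the pieces
  have hΔa := abs_hypDerivWeight_sub_le hφ hB₂ hv hj₂
  have hΔb₁ : |ψ ((j₁ * j₂ : ℕ) : ℝ) - ψ (((j₁ - 1) * j₂ : ℕ) : ℝ)| ≤
      plateauDerivConst 1 / Δ * j₂ := by
    have h := abs_plateauProfile_sub_le (A := A) (B := B) hΔ ((j₁ * j₂ : ℕ) : ℝ) (((j₁ - 1) * j₂ : ℕ) : ℝ)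
    have hd : |((j₁ * j₂ : ℕ) : ℝ) - (((j₁ - 1) * j₂ : ℕ) : ℝ)| = j₂ := by
      have : ((j₁ * j₂ : ℕ) : ℝ) - (((j₁ - 1) * j₂ : ℕ) : ℝ) = j₂ := by
        have e : j₁ * j₂ = (j₁ - 1) * j₂ + j₂ := by
          conv_lhs => rw [show j₁ = (j₁ - 1) + 1 by omega]
          ring
        rw [e]; push_cast; ring
      rw [this, Nat.abs_cast]
    rwa [hd] at h
  have hp : ((j₁ * j₂ : ℕ) : ℝ) = (((j₁ - 1) * j₂ : ℕ) : ℝ) + (j₂ : ℝ) := by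
    have e : j₁ * j₂ = (j₁ - 1) * j₂ + j₂ := by
      conv_lhs => rw [show j₁ = (j₁ - 1) + 1 by omega]
      ring
    rw [e]; push_cast; ring
  have hp' : ((j₁ * (j₂ - 1) : ℕ) : ℝ) = (((j₁ - 1) * (j₂ - 1) : ℕ) : ℝ) + ((j₂ - 1 : ℕ) : ℝ) := by
    have e : j₁ * (j₂ - 1) = (j₁ - 1) * (j₂ - 1) + (j₂ - 1) := by
      conv_lhs => rw [show j₁ = (j₁ - 1) + 1 by omega]
      ring
    rw [e]; push_cast; ring
  have hdd : |(ψ ((j₁ * j₂ : ℕ) : ℝ) - ψ (((j₁ - 1) * j₂ : ℕ) : ℝ)) -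
      (ψ ((j₁ * (j₂ - 1) : ℕ) : ℝ) - ψ (((j₁ - 1) * (j₂ - 1) : ℕ) : ℝ))| ≤
      plateauDerivConst 1 / Δ * 1 +
        plateauDerivConst 2 / Δ ^ 2 * ((j₂ - 1 : ℕ) : ℝ) * ((j₁ - 1 : ℕ) : ℝ) := by
    rw [hp, hp']
    have h := abs_double_diff_plateauProfile_le (A := A) (B := B) hΔ
      (((j₁ - 1) * j₂ : ℕ) : ℝ) (((j₁ - 1) * (j₂ - 1) : ℕ) : ℝ) (j₂ : ℝ) ((j₂ - 1 : ℕ) : ℝ)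
    have e1 : |(j₂ : ℝ) - ((j₂ - 1 : ℕ) : ℝ)| = 1 := by
      rw [Nat.cast_sub hj₂, Nat.cast_one, show (j₂ : ℝ) - ((j₂ : ℝ) - 1) = 1 by ring, abs_one]
    have e2 : |((j₂ - 1 : ℕ) : ℝ)| = ((j₂ - 1 : ℕ) : ℝ) := Nat.abs_cast _
    have e3 : |(((j₁ - 1) * j₂ : ℕ) : ℝ) - (((j₁ - 1) * (j₂ - 1) : ℕ) : ℝ)| = ((j₁ - 1 : ℕ) : ℝ) := by
      have : (((j₁ - 1) * j₂ : ℕ) : ℝ) - (((j₁ - 1) * (j₂ - 1) : ℕ) : ℝ) = ((j₁ - 1 : ℕ) : ℝ) := by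
        have e : (j₁ - 1) * j₂ = (j₁ - 1) * (j₂ - 1) + (j₁ - 1) := by
          conv_lhs => rw [show j₂ = (j₂ - 1) + 1 by omega]
          ring
        rw [e]; push_cast; ring
      rw [this, Nat.abs_cast]
    rw [e1, e2, e3] at h
    exact h
  have ha : |a (j₂ - 1)| ≤ B₁ := abs_hypDerivWeight_le hB₁ v _
  -- combine
  have hj₂pos : (0 : ℝ) < j₂ := by exact_mod_cast hj₂
  calc |(a j₂ - a (j₂ - 1)) * (ψ ((j₁ * j₂ : ℕ) : ℝ) - ψ (((j₁ - 1) * j₂ : ℕ) : ℝ)) +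
        a (j₂ - 1) * ((ψ ((j₁ * j₂ : ℕ) : ℝ) - ψ (((j₁ - 1) * j₂ : ℕ) : ℝ)) -
          (ψ ((j₁ * (j₂ - 1) : ℕ) : ℝ) - ψ (((j₁ - 1) * (j₂ - 1) : ℕ) : ℝ)))|
      ≤ |a j₂ - a (j₂ - 1)| * |ψ ((j₁ * j₂ : ℕ) : ℝ) - ψ (((j₁ - 1) * j₂ : ℕ) : ℝ)| +
          |a (j₂ - 1)| * |(ψ ((j₁ * j₂ : ℕ) : ℝ) - ψ (((j₁ - 1) * j₂ : ℕ) : ℝ)) -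
            (ψ ((j₁ * (j₂ - 1) : ℕ) : ℝ) - ψ (((j₁ - 1) * (j₂ - 1) : ℕ) : ℝ))| := by
        refine (abs_add_le _ _).trans ?_
        rw [abs_mul, abs_mul]
    _ ≤ (2 * B₂ / j₂) * (plateauDerivConst 1 / Δ * j₂) +
          B₁ * (plateauDerivConst 1 / Δ * 1 +
            plateauDerivConst 2 / Δ ^ 2 * ((j₂ - 1 : ℕ) : ℝ) * ((j₁ - 1 : ℕ) : ℝ)) := by
        gcongr
    _ = (2 * B₂ + B₁) * plateauDerivConst 1 / Δ +
          B₁ * plateauDerivConst 2 * (((j₁ - 1 : ℕ) : ℝ) * ((j₂ - 1 : ℕ) : ℝ)) / Δ ^ 2 := by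
        field_simp
        ring

/-- `Δ₁Δ₂G(j₁,j₂) = 0` unless `e^{v-1} ≤ j₂` and `j₂ - 1 ≤ e^{v+1}`. [folklore] -/
theorem mixedDiff_hypWeightC_eq_zero_of_far {φ : ℝ → ℝ} (hφ : IsBump φ) (A B Δ : ℝ) {v : ℝ}
    {j₁ j₂ : ℕ} (h : (j₂ : ℝ) < Real.exp (v - 1) ∨ Real.exp (v + 1) < ((j₂ - 1 : ℕ) : ℝ)) :
    mixedDiff (hypWeightC φ A B Δ v) j₁ j₂ = 0 := by
  have hle : ((j₂ - 1 : ℕ) : ℝ) ≤ j₂ := by exact_mod_cast Nat.sub_le j₂ 1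
  have h1 : hypDerivWeight φ v j₂ = 0 := by
    refine hypDerivWeight_eq_zero hφ ?_
    rcases h with h | h
    · exact Or.inl h
    · exact Or.inr (lt_of_lt_of_le h hle)
  have h2 : hypDerivWeight φ v (j₂ - 1) = 0 := by
    refine hypDerivWeight_eq_zero hφ ?_
    rcases h with h | h
    · exact Or.inl (lt_of_le_of_lt hle h)
    · exact Or.inr h
  rw [mixedDiff_hypWeightC_eq, h1, h2]
  push_cast
  ring

/-- `Δ₁Δ₂G(j₁,j₂) = 0` if `B ≤ (j₁-1)(j₂-1)` (all four `ψ_I`-values vanish). [folklore] -/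
theorem mixedDiff_hypWeightC_eq_zero_of_large (φ : ℝ → ℝ) {A B Δ : ℝ} (hΔ : 0 < Δ) (v : ℝ)
    {j₁ j₂ : ℕ} (h : B ≤ (((j₁ - 1) * (j₂ - 1) : ℕ) : ℝ)) :
    mixedDiff (hypWeightC φ A B Δ v) j₁ j₂ = 0 := by
  have m1 : (j₁ - 1) * (j₂ - 1) ≤ j₁ * j₂ := Nat.mul_le_mul (Nat.sub_le _ _) (Nat.sub_le _ _)
  have m2 : (j₁ - 1) * (j₂ - 1) ≤ (j₁ - 1) * j₂ := Nat.mul_le_mul le_rfl (Nat.sub_le _ _)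
  have m3 : (j₁ - 1) * (j₂ - 1) ≤ j₁ * (j₂ - 1) := Nat.mul_le_mul (Nat.sub_le _ _) le_rfl
  have z : ∀ m : ℕ, (j₁ - 1) * (j₂ - 1) ≤ m → plateauProfile A B Δ (m : ℝ) = 0 := fun m hm =>
    plateauProfile_eq_zero_of_ge hΔ (h.trans (by exact_mod_cast hm))
  rw [mixedDiff_hypWeightC_eq, z _ m1, z _ m2, z _ m3, z _ le_rfl]
  push_cast
  ring

/-- **`∑ |Δ₁Δ₂G|`**: for `v ≥ 2` with `2e ≤ e^v ≤ x`, `0 ≤ B ≤ 3x`, `0 < Δ`, `1 ≤ x`,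
`∑_{1 ≤ j₁ ≤ N₁} ∑_{1 ≤ j₂ ≤ N₂} |Δ₁Δ₂G(j₁,j₂)| ≤ 200 x ((2 sup|φ''| + sup|φ'|) K₁/Δ + 3x sup|φ'| K₂/Δ²)`.
[cite: TaoTeravainen2021, proof of Proposition 7.1 (the estimate for Y)] -/
theorem sum_norm_mixedDiff_hypWeightC_le {φ : ℝ → ℝ} (hφ : IsBump φ) {B₁ B₂ : ℝ}
    (hB₁ : ∀ u, |deriv φ u| ≤ B₁) (hB₂ : ∀ u, |deriv (deriv φ) u| ≤ B₂) {A B Δ v x : ℝ}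
    (hΔ : 0 < Δ) (hx : 1 ≤ x) (hv : 2 ≤ v) (hvx : Real.exp v ≤ x) (hB0 : 0 ≤ B) (hBx : B ≤ 3 * x)
    (N₁ N₂ : ℕ) :
    ∑ j₁ ∈ Finset.Icc 1 N₁, ∑ j₂ ∈ Finset.Icc 1 N₂, ‖mixedDiff (hypWeightC φ A B Δ v) j₁ j₂‖ ≤
      200 * x * ((2 * B₂ + B₁) * plateauDerivConst 1 / Δ +
        B₁ * plateauDerivConst 2 * (3 * x) / Δ ^ 2) := by
  have hB₁0 : 0 ≤ B₁ := (abs_nonneg _).trans (hB₁ 0)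
  have hB₂0 : 0 ≤ B₂ := (abs_nonneg _).trans (hB₂ 0)
  have hK1 := plateauDerivConst_nonneg 1
  have hK2 := plateauDerivConst_nonneg 2
  set P : ℝ := (2 * B₂ + B₁) * plateauDerivConst 1 / Δ +
    B₁ * plateauDerivConst 2 * (3 * x) / Δ ^ 2 with hPdef
  have hP0 : 0 ≤ P := by positivity
  set t : ℝ := Real.exp v with htdef
  have ht1 : Real.exp (v - 1) = t / Real.exp 1 := by rw [Real.exp_sub]
  have ht2 : Real.exp (v + 1) = t * Real.exp 1 := by rw [Real.exp_add]
  have he1 : Real.exp 1 ≤ 3 := by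
    have := Real.exp_one_lt_d9; linarith
  have he2 : 2 ≤ Real.exp 1 := by
    have := Real.exp_one_gt_d9; linarith
  have htv : 2 * Real.exp 1 ≤ t := by
    -- `v ≥ 2` gives `t = e^v ≥ e² ≥ 2e`
    have : Real.exp 2 ≤ t := Real.exp_le_exp.mpr hv
    have h22 : Real.exp 2 = Real.exp 1 * Real.exp 1 := by rw [← Real.exp_add]; norm_num
    nlinarith
  have htpos : 0 < t := Real.exp_pos v
  -- the index boxes
  set J₂ : ℕ := ⌊t * Real.exp 1⌋₊ + 1 with hJ₂def
  set J₁ : ℕ := ⌊B / (t / Real.exp 1 - 1)⌋₊ + 1 with hJ₁def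
  have hden : 0 < t / Real.exp 1 - 1 := by
    rw [sub_pos, lt_div_iff₀ (by positivity)]; linarith
  -- pointwise: every term is `≤ P`, and vanishes outside the box
  have hterm : ∀ j₁ ∈ Finset.Icc 1 N₁, ∀ j₂ ∈ Finset.Icc 1 N₂,
      ‖mixedDiff (hypWeightC φ A B Δ v) j₁ j₂‖ ≤
        if j₁ ≤ J₁ ∧ j₂ ≤ J₂ then P else 0 := by
    intro j₁ hj₁ j₂ hj₂
    rw [Finset.mem_Icc] at hj₁ hj₂
    split_ifs with hbox
    · -- inside the box: the pointwise bound, with `(j₁-1)(j₂-1) < B ≤ 3x` or the term vanishes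
      by_cases hlarge : B ≤ (((j₁ - 1) * (j₂ - 1) : ℕ) : ℝ)
      · rw [mixedDiff_hypWeightC_eq_zero_of_large φ hΔ v hlarge, norm_zero]; exact hP0
      · push Not at hlarge
        refine (norm_mixedDiff_hypWeightC_le hφ hB₁ hB₂ hΔ hv hj₁.1 hj₂.1).trans ?_
        have hprod : ((j₁ - 1 : ℕ) : ℝ) * ((j₂ - 1 : ℕ) : ℝ) ≤ 3 * x := by
          have : (((j₁ - 1) * (j₂ - 1) : ℕ) : ℝ) = ((j₁ - 1 : ℕ) : ℝ) * ((j₂ - 1 : ℕ) : ℝ) := by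
            push_cast; ring
          rw [← this]; linarith
        rw [hPdef]
        gcongr
    · -- outside the box the term vanishes
      rw [not_and_or, not_le, not_le] at hbox
      rcases hbox with hb | hb
      · -- `j₁ > J₁`: either `j₂` is far (vanishing in `a`) or `(j₁-1)(j₂-1) ≥ B`
        by_cases hfar : (j₂ : ℝ) < Real.exp (v - 1)
        · rw [mixedDiff_hypWeightC_eq_zero_of_far hφ A B Δ (Or.inl hfar), norm_zero]
        · push Not at hfar
          rw [ht1] at hfar
          have hj2' : t / Real.exp 1 - 1 ≤ ((j₂ - 1 : ℕ) : ℝ) := by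
            rw [Nat.cast_sub hj₂.1, Nat.cast_one]; linarith
          have hj1' : B / (t / Real.exp 1 - 1) < ((j₁ - 1 : ℕ) : ℝ) := by
            have h1 : (J₁ : ℝ) ≤ ((j₁ - 1 : ℕ) : ℝ) := by exact_mod_cast (by omega : J₁ ≤ j₁ - 1)
            have h2 : B / (t / Real.exp 1 - 1) < (J₁ : ℝ) := by
              rw [hJ₁def]; push_cast; exact Nat.lt_floor_add_one _
            linarith
          have hlarge : B ≤ (((j₁ - 1) * (j₂ - 1) : ℕ) : ℝ) := by
            push_cast [Nat.cast_mul]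
            have hBle : B = B / (t / Real.exp 1 - 1) * (t / Real.exp 1 - 1) := by
              rw [div_mul_cancel₀ B hden.ne']
            have hq0 : 0 ≤ B / (t / Real.exp 1 - 1) := div_nonneg hB0 hden.le
            calc B = B / (t / Real.exp 1 - 1) * (t / Real.exp 1 - 1) := hBle
              _ ≤ ((j₁ - 1 : ℕ) : ℝ) * ((j₂ - 1 : ℕ) : ℝ) :=
                  mul_le_mul hj1'.le hj2' hden.le ((hq0).trans hj1'.le)
          rw [mixedDiff_hypWeightC_eq_zero_of_large φ hΔ v hlarge, norm_zero]
      · -- `j₂ > J₂`: `j₂ - 1 > e t`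
        have hfar : Real.exp (v + 1) < ((j₂ - 1 : ℕ) : ℝ) := by
          rw [ht2]
          have h1 : (J₂ : ℝ) ≤ ((j₂ - 1 : ℕ) : ℝ) := by exact_mod_cast (by omega : J₂ ≤ j₂ - 1)
          have h2 : t * Real.exp 1 < (J₂ : ℝ) := by
            rw [hJ₂def]; push_cast; exact Nat.lt_floor_add_one _
          linarith
        rw [mixedDiff_hypWeightC_eq_zero_of_far hφ A B Δ (Or.inr hfar), norm_zero]
  -- sum the indicator bound
  have hsum : ∑ j₁ ∈ Finset.Icc 1 N₁, ∑ j₂ ∈ Finset.Icc 1 N₂, ‖mixedDiff (hypWeightC φ A B Δ v) j₁ j₂‖ ≤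
      ∑ j₁ ∈ Finset.Icc 1 N₁, ∑ j₂ ∈ Finset.Icc 1 N₂, (if j₁ ≤ J₁ ∧ j₂ ≤ J₂ then P else 0) :=
    sum_le_sum fun j₁ hj₁ => sum_le_sum fun j₂ hj₂ => hterm j₁ hj₁ j₂ hj₂
  refine hsum.trans ?_
  have hbox : ∑ j₁ ∈ Finset.Icc 1 N₁, ∑ j₂ ∈ Finset.Icc 1 N₂, (if j₁ ≤ J₁ ∧ j₂ ≤ J₂ then P else 0) ≤
      (J₁ : ℝ) * J₂ * P := by
    calc ∑ j₁ ∈ Finset.Icc 1 N₁, ∑ j₂ ∈ Finset.Icc 1 N₂, (if j₁ ≤ J₁ ∧ j₂ ≤ J₂ then P else 0)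
        ≤ ∑ j₁ ∈ Finset.Icc 1 J₁, ∑ j₂ ∈ Finset.Icc 1 J₂, P := by
          calc ∑ j₁ ∈ Finset.Icc 1 N₁, ∑ j₂ ∈ Finset.Icc 1 N₂, (if j₁ ≤ J₁ ∧ j₂ ≤ J₂ then P else 0)
              = ∑ j₁ ∈ Finset.Icc 1 N₁, ∑ j₂ ∈ Finset.Icc 1 N₂,
                  ((if j₁ ∈ Finset.Icc 1 J₁ then (1 : ℝ) else 0) * (if j₂ ∈ Finset.Icc 1 J₂ then P else 0)) := by
                refine sum_congr rfl fun j₁ hj₁ => sum_congr rfl fun j₂ hj₂ => ?_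
                rw [Finset.mem_Icc] at hj₁ hj₂
                simp only [Finset.mem_Icc]
                by_cases h1 : j₁ ≤ J₁ <;> by_cases h2 : j₂ ≤ J₂ <;> simp [h1, h2, hj₁.1, hj₂.1]
            _ = (∑ j₁ ∈ Finset.Icc 1 N₁, (if j₁ ∈ Finset.Icc 1 J₁ then (1 : ℝ) else 0)) *
                  ∑ j₂ ∈ Finset.Icc 1 N₂, (if j₂ ∈ Finset.Icc 1 J₂ then P else 0) := by
                rw [sum_mul_sum]
            _ ≤ (∑ j₁ ∈ Finset.Icc 1 J₁, (1 : ℝ)) * ∑ j₂ ∈ Finset.Icc 1 J₂, P := by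
                refine mul_le_mul ?_ ?_ (sum_nonneg fun _ _ => by
                    split_ifs
                    · exact hP0
                    · exact le_rfl)
                  (sum_nonneg fun _ _ => zero_le_one)
                · rw [← sum_filter]
                  refine sum_le_sum_of_subset_of_nonneg (fun j hj => (mem_filter.mp hj).2)
                    fun _ _ _ => zero_le_one
                · rw [← sum_filter]
                  exact sum_le_sum_of_subset_of_nonneg (fun j hj => (mem_filter.mp hj).2)
                    fun _ _ _ => hP0
            _ = ∑ j₁ ∈ Finset.Icc 1 J₁, ∑ j₂ ∈ Finset.Icc 1 J₂, P := by rw [sum_mul_sum]; simp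
      _ = (J₁ : ℝ) * J₂ * P := by
          simp only [sum_const, Nat.card_Icc, add_tsub_cancel_right, nsmul_eq_mul]
          ring
  refine hbox.trans ?_
  -- `J₁ J₂ ≤ 200 x`
  have hJ₂ : (J₂ : ℝ) ≤ 3 * t + 1 := by
    rw [hJ₂def]; push_cast
    have := Nat.floor_le (show 0 ≤ t * Real.exp 1 by positivity)
    nlinarith
  have hJ₁ : (J₁ : ℝ) ≤ 18 * x / t + 1 := by
    rw [hJ₁def]; push_cast
    have h0 : 0 ≤ B / (t / Real.exp 1 - 1) := div_nonneg hB0 hden.le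
    have := Nat.floor_le h0
    have hq : B / (t / Real.exp 1 - 1) ≤ 18 * x / t := by
      -- `t/e - 1 ≥ t/6` since `t ≥ 2e` and `e ≤ 3`
      have hden2 : t / 6 ≤ t / Real.exp 1 - 1 := by
        rw [div_sub_one (by positivity : Real.exp 1 ≠ 0), le_div_iff₀ (by positivity)]
        nlinarith
      calc B / (t / Real.exp 1 - 1) ≤ (3 * x) / (t / 6) :=
            div_le_div₀ (by positivity) hBx (by positivity) hden2
        _ = 18 * x / t := by field_simp; ring
    linarith
  have htx : t ≤ x := hvx
  have hprod : (J₁ : ℝ) * J₂ ≤ 200 * x := by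
    have hxt : 0 < x / t := by positivity
    calc (J₁ : ℝ) * J₂ ≤ (18 * x / t + 1) * (3 * t + 1) :=
          mul_le_mul hJ₁ hJ₂ (by positivity) (by positivity)
      _ = 54 * x + 18 * (x / t) + 3 * t + 1 := by field_simp; ring
      _ ≤ 54 * x + 18 * x + 3 * x + x := by
          have : x / t ≤ x := by
            rw [div_le_iff₀ htpos]
            have : (1 : ℝ) ≤ t := by linarith
            nlinarith
          linarith
      _ ≤ 200 * x := by linarith
  calc (J₁ : ℝ) * J₂ * P ≤ 200 * x * P := mul_le_mul_of_nonneg_right hprod hP0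
    _ = _ := by rw [hPdef]

/-! ### The `Y`-bound for one frequency pair -/

/-- **The `Y`-bound**: for `|z₁| = |z₂| = 1`, `z₁, z₂ ≠ 1`, `0 ≤ A`, `Δ > 0`,
`|∑_{n₁,n₂ ≤ M} G(n₁,n₂) z₁^{n₁} z₂^{n₂}| ≤ 4 (∑_{j₁,j₂ ≥ 1} |Δ₁Δ₂G(j₁,j₂)|)/(|z₁-1| |z₂-1|)`
("From repeated summation by parts …"). [cite: TaoTeravainen2021, proof of Proposition 7.1 (the
estimate for Y)] -/
theorem norm_sum_hypWeightC_mul_pow_le (φ : ℝ → ℝ) {A B Δ : ℝ} (hA : 0 ≤ A) (hΔ : 0 < Δ) (v : ℝ)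
    (M : ℕ) {z₁ z₂ : ℂ} (hz₁ : ‖z₁‖ = 1) (hz₁1 : z₁ ≠ 1) (hz₂ : ‖z₂‖ = 1) (hz₂1 : z₂ ≠ 1) :
    ‖∑ n₁ ∈ range (M + 1), ∑ n₂ ∈ range (M + 1), hypWeightC φ A B Δ v n₁ n₂ * z₁ ^ n₁ * z₂ ^ n₂‖ ≤
      4 / (‖z₁ - 1‖ * ‖z₂ - 1‖) *
        ∑ j₁ ∈ Finset.Icc 1 M, ∑ j₂ ∈ Finset.Icc 1 M, ‖mixedDiff (hypWeightC φ A B Δ v) j₁ j₂‖ :=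
  norm_sum_sum_mul_pow_pow_le (hypWeightC φ A B Δ v) M M
    (fun n₂ => by unfold hypWeightC; rw [hypWeight_zero_left hA hΔ, Complex.ofReal_zero])
    (fun n₁ => by unfold hypWeightC; rw [hypWeight_zero_right, Complex.ofReal_zero]) hz₁ hz₁1 hz₂ hz₂1


end TaoTeravainen

end Literature.Barriers.Parity
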